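import Summits.ABC.IUTFork.Repair.RHSigmaCellCreditAbcExp
import Summits.ABC.IUTFork.Repair.RHSigmaMassGap
import HarnessLib

/-!
# D-0121 (1)(b) T-OPTIMALITY, the GLUE (sequel): THE CONE-SIDE CHARGE OF EVERY TIER — «whatever is netted on the q-side is charged on the cone side»
# as kernel inequalities at the chosen bed (rh-lead g3 R30 (3)/(4), R33 (3)/(e): the RE-RUN statement's cone column, BY NAME)

PROOF-ONLY sequel (0 definitions, 0 `Prop` facts, no instance, no notation; nothing re-typed; imports q2-eq p486022 + w-1 p478601 only, so it builds
independently of its prequel's olean) of `Conditional/AbcExpOfSigmaMassFinanced.lean` (p489258, this seat) — abc-iut cell, rung LADDER-ABC:A2.RESCUE.H, seat abc-iut-topt-pv-3 (D-0121 (1)(b) prover 3/3). rh-lead g3 R29 (02:42:43Z) fixed the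
INFORMATION × NETTING grid of the human's T-OPTIMALITY question (per datum, six slacks `ε_X`: LIC/none `T = (1−μ)M` · LIC/netting `T − C_σ` · EX/none
`(1−μ_ex)M` · EX/netting `M − Π` = the least slack `D(T)`, ± within/across places), R30 (3) pre-registered the COUPLING SENTENCE «whatever is netted on the
q-side is charged on the cone side — the [CONE-C] binder of the EXP twins must bound the ACTUAL hull log-volumes used as credit», R33 (3) confirmed it BY
DECL ([CONE-C] = `hregC` ⟹ `T.HullEstimateOf δ := negLogThetaNonarch ≤ −ndegLgp(P_Θ) + δ` on the very hulls whose room is the credit) and R33 (e) asked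
this seat for «the RE-RUN statement = `Statement` at the sharp setting from EX cells with credit, cone side explicit». This file is that cone side, as
four inequalities every tier's kept mass obeys at any datum where the cone binder holds, and the one-datum N14-shape corollary.

COMPOSED BY NAME from: abc-iut-rh2-xi-1's squeeze `RH.OffSigma.gap_le_of_cor312UpTo` (p469145: «Cor. 3.12 up to `B`» ∧ `HullEstimateOf δ` ⟹ `T.gap ≤ δ + B +
((l+5)/4)·log π`), q2-eq's adapter `RH.SigmaStrataEq.cor312UpTo_of_statementUpTo_chosen` (p484564) and doors `statementUpTo_signedRemainder` (p480491) /
`weightedTrivialMass_eq_totalTrivialMass_sub` (p484504), abc-iut-rh2-w-1's `RH.CellWeights.totalTrivialMass_chosen_eq_gap` (p478601), rh2-T-1's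
`onTrivialMass_add_offTrivialMass` (p477034), and §1 of the prequel (`statementUpTo_onCharge_add_offTrivialMass`, the financed door — re-derived inline in three lines, not re-declared).

WHAT IS TYPED (at the CHOSEN realising ideles of a genuine Θ-volume datum `T : Cor22.ThetaVolumeDatumAt P l`, every context `M … qData` of abc-iut-c312-7's
sharp setting; `arch(l) := ThetaVolumeInput.archLogTheta l = ((l+5)/4)·log π`; `M(T) = totalTrivialMass = T.gap`; `δ` a FREE real — print's value is
`B_III(P,l)`, the argument of `hregC`):
* §1 **`gap_sub_le_of_statementUpTo_of_hullEstimateOf_chosen`** — THE CONE CHARGE OF A TIER: for EVERY slack `ε`, `StatementUpTo (setting) ε ∧ T.HullEstimateOf δ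
  ⟹ T.gap − ε ≤ δ + arch(l)`: the KEPT mass `κ_X·M = M − ε_X` of ANY tier X is a LOWER BOUND the cone binder must absorb («[CONE-C] at the datum needs
  `δ ≥ κ_X(T)·M(T) − arch(l)`»). Instances BY NAME: **`onTrivialMass_add_credit_le_of_hullEstimateOf_chosen`** (LIC/netting — the FINANCED corner of the prequel:
  `mass(σ) + C_σ ≤ δ + arch(l)` for every stratum `σ`, `C_σ = −weightedDeficit 1_σ` the netted on-σ surplus — the credit one nets on the q-side reappears,
  nat for nat, on the cone side), **`totalTrivialMass_sub_signedRemainder_le_of_hullEstimateOf_chosen`** (EX/netting — `Π(T) := M − D(T) ≤ δ + arch(l)`: the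
  total PRICE, across-places credit included, is what the cone binder pays for; R33 (4)'s scaling sentence compares this conductor-type `Π − μ_ex·M` with
  `B_III`), **`keptMass_le_of_weightedDeficit_nonpos_of_hullEstimateOf_chosen`** (any scheme `ω ≤ 1` with `weightedDeficit ω ≤ 0`: kept ω-mass `≤ δ + arch(l)`).
* §2 **`mu_mul_gap_le_of_offSigmaTolerance_of_hullEstimateOf_chosen`** — THE TWO BINDERS OF EVERY EXPONENT END, MET AT ONE DATUM: for every slack `ε` certified at
  the setting, [MU](μ₀) `OffSigmaTolerance (1 − μ₀) A T ε` ∧ [CONE] `T.HullEstimateOf δ` ⟹ `μ₀·T.gap ≤ δ + A + arch(l)` — the abc-type inequality AT THAT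
  DATUM with constant `1/μ₀` (N14 shape: on a datum with `μ₀·T.gap > B_III + Tol + arch` the two binders are jointly unsatisfiable, whichever tier certified `ε`).
  READING for the RE-RUN table (ROUND3/RERUN-STATEMENT-topt-pv-3.md): next to each tier's kept fraction `κ_X(T)` tabulate the cone charge `κ_X·M − arch` against
  `B_III(P,l)`; in the window model (`B_III/M ≈ 1/s(T)`, `s` the datum's Szpiro ratio over 6) a tier is cone-consistent at `T` iff `κ_X(T) ≲ 1/s(T)` — so on the
  Szpiro-bad bed (`s > 1`) «`π = 1` by across-places netting» is the statement that the cone binder FAILS there (R33 (2)–(3)), not a free exponent.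
HONEST FRAMING: elementary inequalities between DEFINED numbers of OUR typed hull at the chosen ideles and the FREE cone parameter `δ`; [CONE]/[MU] are
ASSUMPTION LABELS, never asserted for any datum; NO tabulated datum lies on the content locus; nothing here asserts that abc (with any exponent) is proved or
refuted, or that [IUTchIII] Cor. 3.12 / [IUTchIV] Thm. 1.10 holds or fails at any datum, or takes a side on any author (Mochizuki / Scholze–Stix / Joshi /
Dupuy–Hilado); typed ≠ proved; computed ≠ proved; instantiated ≠ endorsed. [claim: Mochizuki2012, status: disputed] for every IUT locution.
[cite: Mochizuki2012, IUTchIII Cor. 3.12 p. 173–174; IUTchIV Thm. 1.10 Steps (iii)–(x) pp. 26–32, Cor. 2.2 (ii) p. 46] [cite: DupuyHilado2025, §1 (1.1), §3.9]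
-/

noncomputable section

open Set Function NumberField IsDedekindDomain

namespace Summit.ABC.IUTFork.Conditional.SigmaMass

open Summit.ABC.IUTFork.Thm311 Summit.ABC.IUTFork.Thm311.Real Summit.ABC.IUTFork.Cor312 Summit.ABC.IUTFork.Cor312.Setting
  Summit.ABC.IUTFork.Cor312Vol Summit.ABC.IUTFork.Cor312Prov Literature.IUT.LogThetaLattice Literature.IUT.LogVolume
  Literature.IUT.HodgeTheaters Literature.IUT.LogVolume.ThetaData
  Literature.NumberTheory.DiophantineGeometry Literature.NumberTheory.DiophantineGeometry.GenEll Summit.ABC.ABC.Theorems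
  Summit.ABC.IUTFork.Repair.RH.SigmaLicence Summit.ABC.IUTFork.Repair.RH.SigmaStrataEq Summit.ABC.IUTFork.Repair.RH.SigmaMass
  Summit.ABC.IUTFork.Repair.RH.OffSigma Summit.ABC.IUTFork.Repair.RH.CellWeights Summit.ABC.IUTFork.Conditional

/-! ## §1. The cone charge of a tier: kept mass `≤ δ + arch(l)` wherever the cone binder `HullEstimateOf δ` holds -/

/-- **THE CONE CHARGE OF A TIER.** At the chosen bed of a genuine Θ-volume datum `T`, for EVERY slack `ε` and every cone parameter `δ`: «Cor. 3.12 up to `ε`»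
for OUR typed hull (`StatementUpTo (setting) ε` — whichever tier certified it: licence-only `ε = B_triv(σᶜ)`, financed `ε = F(σ)`, a scheme `ε =
weightedTrivialMass ω`, the least slack `ε = D(T)`) together with the cone binder `T.HullEstimateOf δ` gives **`T.gap − ε ≤ δ + ((l+5)/4)·log π`** — the tier's
KEPT mass `M − ε` is charged, nat for nat, on the cone side (abc-iut-rh2-xi-1 `gap_le_of_cor312UpTo` ∘ q2-eq `cor312UpTo_of_statementUpTo_chosen`; rh-lead g3
R30 (3)). Print's `δ` is `B_III(P,l)`. «holds AS TYPED»; no side taken. [cite: Mochizuki2012, IUTchIV Thm. 1.10 Steps (viii)–(x) p. 30–32] [claim: Mochizuki2012, status: disputed] -/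
theorem gap_sub_le_of_statementUpTo_of_hullEstimateOf_chosen {P : NFPoint} {l : ℕ} (T : Cor22.ThetaVolumeDatumAt P l) :
    letI := T.instFieldF; letI := T.instNumberFieldF; letI := T.instAlgebraF; letI := T.instFieldK;
        letI := T.instNumberFieldK; letI := T.instAlgebraK; letI := T.instFieldFbar; letI := T.instAlgebraFbar;
        letI := T.instAlgebraKFbar; letI := T.instIsElliptic;
    ∀ (M : Type) [Field M] [NumberField M]
      (archPk : ∀ (j : (thetaIndex (pilotDataOfK T.D T.K)).Label) (vQ : (thetaIndex (pilotDataOfK T.D T.K)).VQ),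
        Set ((logShellsDH (pilotDataOfK T.D T.K) (analyticLogv T.K)).Packet j vQ))
      (archSub : ∀ (j : (thetaIndex (pilotDataOfK T.D T.K)).Label) (v : (thetaIndex (pilotDataOfK T.D T.K)).V),
        Set ((logShellsDH (pilotDataOfK T.D T.K) (analyticLogv T.K)).Packet j ((thetaIndex (pilotDataOfK T.D T.K)).over v)))
      (Ψ : ℤ → ∀ v : (thetaIndex (pilotDataOfK T.D T.K)).V, v ∈ (thetaIndex (pilotDataOfK T.D T.K)).Vbad →
        Set ((logShellsDH (pilotDataOfK T.D T.K) (analyticLogv T.K)).StarPacket v))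
      (act : ℤ → ∀ v : (thetaIndex (pilotDataOfK T.D T.K)).V, v ∈ (thetaIndex (pilotDataOfK T.D T.K)).Vbad →
        (logShellsDH (pilotDataOfK T.D T.K) (analyticLogv T.K)).StarPacket v →
          Module.End ℚ ((logShellsDH (pilotDataOfK T.D T.K) (analyticLogv T.K)).StarPacket v))
      (Mmod : ℤ → ∀ j : (thetaIndex (pilotDataOfK T.D T.K)).LabelStar,
        Set ((logShellsDH (pilotDataOfK T.D T.K) (analyticLogv T.K)).GlobalPacket j.1))
      (region : ℤ → ∀ j : (thetaIndex (pilotDataOfK T.D T.K)).LabelStar, FinDivisor M →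
        ∀ vQ : (thetaIndex (pilotDataOfK T.D T.K)).VQ, Set ((logShellsDH (pilotDataOfK T.D T.K) (analyticLogv T.K)).Packet j.1 vQ))
      (n : ℤ) {HT : Type} {LogLink : HT → HT → Type} {IsFull : ∀ {s t : HT}, LogLink s t → Prop}
      (lat : LGPGaussianLogThetaLattice LogLink IsFull)
      {Frd : Type} {IsoF : Frd → Frd → Type} {Ob : Frd → Type} {realify : Frd → Frd} {Strip : Type}
      {IsoS : Strip → Strip → Type}
      {Mv : ∀ v : (thetaIndex (pilotDataOfK T.D T.K)).V, v ∈ (thetaIndex (pilotDataOfK T.D T.K)).Vbad → Type}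
      [∀ v h, Monoid (Mv v h)]
      (sig : GlobalLGPFrobenioidSignature (thetaIndex (pilotDataOfK T.D T.K)).lstar (thetaIndex (pilotDataOfK T.D T.K)).V
        (· ∈ (thetaIndex (pilotDataOfK T.D T.K)).Vbad) Frd IsoF Ob realify Strip IsoS Mv)
      (split : SplittingMonoids Mv) {ObΔ : Type}
      {N : ∀ v : (thetaIndex (pilotDataOfK T.D T.K)).V, v ∈ (thetaIndex (pilotDataOfK T.D T.K)).Vbad → Type} [∀ v h, Monoid (N v h)]
      (qData : QPilotData ObΔ N) (ε δ : ℝ),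
      StatementUpTo
          (settingPrVolSharp (pilotDataOfK T.D T.K) (logvAnalytic_analyticLogv (F := T.K)) M archPk archSub Ψ act Mmod region n lat
            sig split qData (exists_realising_qIdeles_pilotDataOfK T.D).choose (exists_realising_thetaIdeles_pilotDataOfK T.D).choose
            (exists_realising_qIdeles_pilotDataOfK T.D).choose_spec.1 (exists_realising_qIdeles_pilotDataOfK T.D).choose_spec.2.1) ε →
      T.HullEstimateOf δ → T.gap - ε ≤ δ + ThetaVolumeInput.archLogTheta l := by
  intro M _ _ archPk archSub Ψ act Mmod region n HT LogLink IsFull lat Frd IsoF Ob realify Strip IsoS Mv _ sig split ObΔ N _ qData ε δ hst hδ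
  letI := T.instFieldF; letI := T.instNumberFieldF; letI := T.instAlgebraF; letI := T.instFieldK
  letI := T.instNumberFieldK; letI := T.instAlgebraK; letI := T.instFieldFbar; letI := T.instAlgebraFbar
  letI := T.instAlgebraKFbar; letI := T.instIsElliptic
  have h1 := cor312UpTo_of_statementUpTo_chosen T M archPk archSub Ψ act Mmod region n lat sig split qData ε hst
  have h2 := gap_le_of_cor312UpTo T (B := ε) (by linarith) hδ
  linarith

/-- **THE FINANCED CORNER'S CONE CHARGE (LIC/netting, rh-lead R29): `mass(σ) + C_σ ≤ δ + ((l+5)/4)·log π`** for EVERY stratum `σ` at any datum where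
`T.HullEstimateOf δ` holds — `C_σ = −weightedDeficit (setting) 1_σ` the NETTED on-σ surplus that the prequel's financed door
`statementUpTo_onCharge_add_offTrivialMass` spends on the q-side (`T′ = T − C_σ`) is paid back in full on the cone side: the financed kept mass can exceed the
licence-only kept mass `mass(σ)` only by volume the cone binder must ALSO cover (R30 (3) «moves the cost into [CONE-C], does not remove it»; R33 (4): `C_σ` is
conductor-type, `mass` is height-type). «holds AS TYPED»; no side taken. [cite: Mochizuki2012, IUTchIV Thm. 1.10 Steps (iii), (viii)–(x) pp. 26–32] [claim: Mochizuki2012, status: disputed] -/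
theorem onTrivialMass_add_credit_le_of_hullEstimateOf_chosen {P : NFPoint} {l : ℕ} (T : Cor22.ThetaVolumeDatumAt P l) :
    letI := T.instFieldF; letI := T.instNumberFieldF; letI := T.instAlgebraF; letI := T.instFieldK;
        letI := T.instNumberFieldK; letI := T.instAlgebraK; letI := T.instFieldFbar; letI := T.instAlgebraFbar;
        letI := T.instAlgebraKFbar; letI := T.instIsElliptic;
    ∀ (M : Type) [Field M] [NumberField M]
      (archPk : ∀ (j : (thetaIndex (pilotDataOfK T.D T.K)).Label) (vQ : (thetaIndex (pilotDataOfK T.D T.K)).VQ),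
        Set ((logShellsDH (pilotDataOfK T.D T.K) (analyticLogv T.K)).Packet j vQ))
      (archSub : ∀ (j : (thetaIndex (pilotDataOfK T.D T.K)).Label) (v : (thetaIndex (pilotDataOfK T.D T.K)).V),
        Set ((logShellsDH (pilotDataOfK T.D T.K) (analyticLogv T.K)).Packet j ((thetaIndex (pilotDataOfK T.D T.K)).over v)))
      (Ψ : ℤ → ∀ v : (thetaIndex (pilotDataOfK T.D T.K)).V, v ∈ (thetaIndex (pilotDataOfK T.D T.K)).Vbad →
        Set ((logShellsDH (pilotDataOfK T.D T.K) (analyticLogv T.K)).StarPacket v))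
      (act : ℤ → ∀ v : (thetaIndex (pilotDataOfK T.D T.K)).V, v ∈ (thetaIndex (pilotDataOfK T.D T.K)).Vbad →
        (logShellsDH (pilotDataOfK T.D T.K) (analyticLogv T.K)).StarPacket v →
          Module.End ℚ ((logShellsDH (pilotDataOfK T.D T.K) (analyticLogv T.K)).StarPacket v))
      (Mmod : ℤ → ∀ j : (thetaIndex (pilotDataOfK T.D T.K)).LabelStar,
        Set ((logShellsDH (pilotDataOfK T.D T.K) (analyticLogv T.K)).GlobalPacket j.1))
      (region : ℤ → ∀ j : (thetaIndex (pilotDataOfK T.D T.K)).LabelStar, FinDivisor M →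
        ∀ vQ : (thetaIndex (pilotDataOfK T.D T.K)).VQ, Set ((logShellsDH (pilotDataOfK T.D T.K) (analyticLogv T.K)).Packet j.1 vQ))
      (n : ℤ) {HT : Type} {LogLink : HT → HT → Type} {IsFull : ∀ {s t : HT}, LogLink s t → Prop}
      (lat : LGPGaussianLogThetaLattice LogLink IsFull)
      {Frd : Type} {IsoF : Frd → Frd → Type} {Ob : Frd → Type} {realify : Frd → Frd} {Strip : Type}
      {IsoS : Strip → Strip → Type}
      {Mv : ∀ v : (thetaIndex (pilotDataOfK T.D T.K)).V, v ∈ (thetaIndex (pilotDataOfK T.D T.K)).Vbad → Type}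
      [∀ v h, Monoid (Mv v h)]
      (sig : GlobalLGPFrobenioidSignature (thetaIndex (pilotDataOfK T.D T.K)).lstar (thetaIndex (pilotDataOfK T.D T.K)).V
        (· ∈ (thetaIndex (pilotDataOfK T.D T.K)).Vbad) Frd IsoF Ob realify Strip IsoS Mv)
      (split : SplittingMonoids Mv) {ObΔ : Type}
      {N : ∀ v : (thetaIndex (pilotDataOfK T.D T.K)).V, v ∈ (thetaIndex (pilotDataOfK T.D T.K)).Vbad → Type} [∀ v h, Monoid (N v h)]
      (qData : QPilotData ObΔ N)
      (σ : Set (Fin (thetaIndex (pilotDataOfK T.D T.K)).lstar × (thetaIndex (pilotDataOfK T.D T.K)).VQ)) (δ : ℝ),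
      T.HullEstimateOf δ →
      onTrivialMass
          (settingPrVolSharp (pilotDataOfK T.D T.K) (logvAnalytic_analyticLogv (F := T.K)) M archPk archSub Ψ act Mmod region n lat
            sig split qData (exists_realising_qIdeles_pilotDataOfK T.D).choose (exists_realising_thetaIdeles_pilotDataOfK T.D).choose
            (exists_realising_qIdeles_pilotDataOfK T.D).choose_spec.1 (exists_realising_qIdeles_pilotDataOfK T.D).choose_spec.2.1) σ +
        -weightedDeficit
          (settingPrVolSharp (pilotDataOfK T.D T.K) (logvAnalytic_analyticLogv (F := T.K)) M archPk archSub Ψ act Mmod region n lat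
            sig split qData (exists_realising_qIdeles_pilotDataOfK T.D).choose (exists_realising_thetaIdeles_pilotDataOfK T.D).choose
            (exists_realising_qIdeles_pilotDataOfK T.D).choose_spec.1 (exists_realising_qIdeles_pilotDataOfK T.D).choose_spec.2.1) (σ.indicator fun _ => (1 : ℝ)) ≤
        δ + ThetaVolumeInput.archLogTheta l := by
  intro M _ _ archPk archSub Ψ act Mmod region n HT LogLink IsFull lat Frd IsoF Ob realify Strip IsoS Mv _ sig split ObΔ N _ qData σ δ hδ
  letI := T.instFieldF; letI := T.instNumberFieldF; letI := T.instAlgebraF; letI := T.instFieldK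
  letI := T.instNumberFieldK; letI := T.instAlgebraK; letI := T.instFieldFbar; letI := T.instAlgebraFbar
  letI := T.instAlgebraKFbar; letI := T.instIsElliptic
  have H := bridgeHyps_settingPrVolSharp_of_ideles (pilotDataOfK T.D T.K) (logvAnalytic_analyticLogv (F := T.K)) M archPk archSub Ψ act
    Mmod region n lat sig split qData (exists_realising_thetaIdeles_pilotDataOfK T.D).choose (exists_realising_qIdeles_pilotDataOfK T.D).choose
    (exists_realising_thetaIdeles_pilotDataOfK T.D).choose_spec.1 (exists_realising_thetaIdeles_pilotDataOfK T.D).choose_spec.2.1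
    (exists_realising_qIdeles_pilotDataOfK T.D).choose_spec.1 (exists_realising_qIdeles_pilotDataOfK T.D).choose_spec.2.1
  -- the prequel's financed door `statementUpTo_onCharge_add_offTrivialMass` (p489258), re-derived in three lines so that this file does not wait on its olean
  have hF : StatementUpTo
      (settingPrVolSharp (pilotDataOfK T.D T.K) (logvAnalytic_analyticLogv (F := T.K)) M archPk archSub Ψ act Mmod region n lat
            sig split qData (exists_realising_qIdeles_pilotDataOfK T.D).choose (exists_realising_thetaIdeles_pilotDataOfK T.D).choose
            (exists_realising_qIdeles_pilotDataOfK T.D).choose_spec.1 (exists_realising_qIdeles_pilotDataOfK T.D).choose_spec.2.1) (weightedDeficit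
          (settingPrVolSharp (pilotDataOfK T.D T.K) (logvAnalytic_analyticLogv (F := T.K)) M archPk archSub Ψ act Mmod region n lat
            sig split qData (exists_realising_qIdeles_pilotDataOfK T.D).choose (exists_realising_thetaIdeles_pilotDataOfK T.D).choose
            (exists_realising_qIdeles_pilotDataOfK T.D).choose_spec.1 (exists_realising_qIdeles_pilotDataOfK T.D).choose_spec.2.1) (σ.indicator fun _ => (1 : ℝ)) +
        offTrivialMass
          (settingPrVolSharp (pilotDataOfK T.D T.K) (logvAnalytic_analyticLogv (F := T.K)) M archPk archSub Ψ act Mmod region n lat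
            sig split qData (exists_realising_qIdeles_pilotDataOfK T.D).choose (exists_realising_thetaIdeles_pilotDataOfK T.D).choose
            (exists_realising_qIdeles_pilotDataOfK T.D).choose_spec.1 (exists_realising_qIdeles_pilotDataOfK T.D).choose_spec.2.1) σ) := by
    have h := signedRemainder_le_weightedDeficit_add_weightedTrivialMass H (ω := σ.indicator fun _ => (1 : ℝ)) fun c => by
      by_cases hc : c ∈ σ
      · rw [Set.indicator_of_mem hc]
      · rw [Set.indicator_of_notMem hc]; exact zero_le_one
    rw [weightedTrivialMass_indicator] at h
    exact (statementUpTo_iff_signedRemainder_le H _).mpr h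
  have h1 := gap_sub_le_of_statementUpTo_of_hullEstimateOf_chosen T M archPk archSub Ψ act Mmod region n lat sig split qData _ δ hF hδ
  have h2 := totalTrivialMass_chosen_eq_gap T M archPk archSub Ψ act Mmod region n lat sig split qData
  have h3 := onTrivialMass_add_offTrivialMass H σ
  linarith

/-- **THE FULLY NETTED CORNER'S CONE CHARGE (EX/netting, across places): `Π(T) := M(T) − D(T) ≤ δ + ((l+5)/4)·log π`** at any datum where `T.HullEstimateOf δ`
holds — `D(T) = signedRemainder (setting)` the least slack (q2-eq p479556/p480491, certified hypothesis-free), so `M − D` is the TOTAL netted volume excess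
(«total price `Π`» of R29 at EX information, across-places credit included): the one scalar inequality print uses (topt-rf-1 PRINT-WEIGHTS §2: Cor. 3.12 ⟹
Thm. 1.10 nets everything once) charges exactly this on the cone side. With `D(T) ≤ 0` («`π = 1`», R33 (2)) it reads `M(T) = T.gap ≤ δ + arch` — abc at the
datum, i.e. on a Szpiro-bad datum the cone binder fails (N14). «holds AS TYPED»; no side taken. [cite: Mochizuki2012, IUTchIV Thm. 1.10 Steps (iii), (viii)–(x) pp. 26–32]
[claim: Mochizuki2012, status: disputed] -/
theorem totalTrivialMass_sub_signedRemainder_le_of_hullEstimateOf_chosen {P : NFPoint} {l : ℕ} (T : Cor22.ThetaVolumeDatumAt P l) :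
    letI := T.instFieldF; letI := T.instNumberFieldF; letI := T.instAlgebraF; letI := T.instFieldK;
        letI := T.instNumberFieldK; letI := T.instAlgebraK; letI := T.instFieldFbar; letI := T.instAlgebraFbar;
        letI := T.instAlgebraKFbar; letI := T.instIsElliptic;
    ∀ (M : Type) [Field M] [NumberField M]
      (archPk : ∀ (j : (thetaIndex (pilotDataOfK T.D T.K)).Label) (vQ : (thetaIndex (pilotDataOfK T.D T.K)).VQ),
        Set ((logShellsDH (pilotDataOfK T.D T.K) (analyticLogv T.K)).Packet j vQ))
      (archSub : ∀ (j : (thetaIndex (pilotDataOfK T.D T.K)).Label) (v : (thetaIndex (pilotDataOfK T.D T.K)).V),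
        Set ((logShellsDH (pilotDataOfK T.D T.K) (analyticLogv T.K)).Packet j ((thetaIndex (pilotDataOfK T.D T.K)).over v)))
      (Ψ : ℤ → ∀ v : (thetaIndex (pilotDataOfK T.D T.K)).V, v ∈ (thetaIndex (pilotDataOfK T.D T.K)).Vbad →
        Set ((logShellsDH (pilotDataOfK T.D T.K) (analyticLogv T.K)).StarPacket v))
      (act : ℤ → ∀ v : (thetaIndex (pilotDataOfK T.D T.K)).V, v ∈ (thetaIndex (pilotDataOfK T.D T.K)).Vbad →
        (logShellsDH (pilotDataOfK T.D T.K) (analyticLogv T.K)).StarPacket v →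
          Module.End ℚ ((logShellsDH (pilotDataOfK T.D T.K) (analyticLogv T.K)).StarPacket v))
      (Mmod : ℤ → ∀ j : (thetaIndex (pilotDataOfK T.D T.K)).LabelStar,
        Set ((logShellsDH (pilotDataOfK T.D T.K) (analyticLogv T.K)).GlobalPacket j.1))
      (region : ℤ → ∀ j : (thetaIndex (pilotDataOfK T.D T.K)).LabelStar, FinDivisor M →
        ∀ vQ : (thetaIndex (pilotDataOfK T.D T.K)).VQ, Set ((logShellsDH (pilotDataOfK T.D T.K) (analyticLogv T.K)).Packet j.1 vQ))
      (n : ℤ) {HT : Type} {LogLink : HT → HT → Type} {IsFull : ∀ {s t : HT}, LogLink s t → Prop}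
      (lat : LGPGaussianLogThetaLattice LogLink IsFull)
      {Frd : Type} {IsoF : Frd → Frd → Type} {Ob : Frd → Type} {realify : Frd → Frd} {Strip : Type}
      {IsoS : Strip → Strip → Type}
      {Mv : ∀ v : (thetaIndex (pilotDataOfK T.D T.K)).V, v ∈ (thetaIndex (pilotDataOfK T.D T.K)).Vbad → Type}
      [∀ v h, Monoid (Mv v h)]
      (sig : GlobalLGPFrobenioidSignature (thetaIndex (pilotDataOfK T.D T.K)).lstar (thetaIndex (pilotDataOfK T.D T.K)).V
        (· ∈ (thetaIndex (pilotDataOfK T.D T.K)).Vbad) Frd IsoF Ob realify Strip IsoS Mv)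
      (split : SplittingMonoids Mv) {ObΔ : Type}
      {N : ∀ v : (thetaIndex (pilotDataOfK T.D T.K)).V, v ∈ (thetaIndex (pilotDataOfK T.D T.K)).Vbad → Type} [∀ v h, Monoid (N v h)]
      (qData : QPilotData ObΔ N) (δ : ℝ),
      T.HullEstimateOf δ →
      totalTrivialMass
          (settingPrVolSharp (pilotDataOfK T.D T.K) (logvAnalytic_analyticLogv (F := T.K)) M archPk archSub Ψ act Mmod region n lat
            sig split qData (exists_realising_qIdeles_pilotDataOfK T.D).choose (exists_realising_thetaIdeles_pilotDataOfK T.D).choose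
            (exists_realising_qIdeles_pilotDataOfK T.D).choose_spec.1 (exists_realising_qIdeles_pilotDataOfK T.D).choose_spec.2.1) -
        signedRemainder
          (settingPrVolSharp (pilotDataOfK T.D T.K) (logvAnalytic_analyticLogv (F := T.K)) M archPk archSub Ψ act Mmod region n lat
            sig split qData (exists_realising_qIdeles_pilotDataOfK T.D).choose (exists_realising_thetaIdeles_pilotDataOfK T.D).choose
            (exists_realising_qIdeles_pilotDataOfK T.D).choose_spec.1 (exists_realising_qIdeles_pilotDataOfK T.D).choose_spec.2.1) ≤
        δ + ThetaVolumeInput.archLogTheta l := by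
  intro M _ _ archPk archSub Ψ act Mmod region n HT LogLink IsFull lat Frd IsoF Ob realify Strip IsoS Mv _ sig split ObΔ N _ qData δ hδ
  letI := T.instFieldF; letI := T.instNumberFieldF; letI := T.instAlgebraF; letI := T.instFieldK
  letI := T.instNumberFieldK; letI := T.instAlgebraK; letI := T.instFieldFbar; letI := T.instAlgebraFbar
  letI := T.instAlgebraKFbar; letI := T.instIsElliptic
  have H := bridgeHyps_settingPrVolSharp_of_ideles (pilotDataOfK T.D T.K) (logvAnalytic_analyticLogv (F := T.K)) M archPk archSub Ψ act
    Mmod region n lat sig split qData (exists_realising_thetaIdeles_pilotDataOfK T.D).choose (exists_realising_qIdeles_pilotDataOfK T.D).choose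
    (exists_realising_thetaIdeles_pilotDataOfK T.D).choose_spec.1 (exists_realising_thetaIdeles_pilotDataOfK T.D).choose_spec.2.1
    (exists_realising_qIdeles_pilotDataOfK T.D).choose_spec.1 (exists_realising_qIdeles_pilotDataOfK T.D).choose_spec.2.1
  have h1 := gap_sub_le_of_statementUpTo_of_hullEstimateOf_chosen T M archPk archSub Ψ act Mmod region n lat sig split qData _ δ (statementUpTo_signedRemainder H) hδ
  have h2 := totalTrivialMass_chosen_eq_gap T M archPk archSub Ψ act Mmod region n lat sig split qData
  linarith

/-- **A SCHEME'S CONE CHARGE (any tier through the weighted door): kept ω-mass `PN Σᶠ ω·t ≤ δ + ((l+5)/4)·log π`** for every weight `ω ≤ 1` with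
`weightedDeficit (setting) ω ≤ 0` at any datum where `T.HullEstimateOf δ` holds (kept mass `= weightedTrivialMass (1 − ω)`, q2-eq `weightedTrivialMass_eq_totalTrivialMass_sub`).
So the D0121-SPEC sentence «[W-C](ω) ∧ kept ω-mass ≥ μ_fin·M − Tol ∧ [CONE-C]» carries, at each datum, `μ_fin·M − Tol ≤ δ + arch`. «holds AS TYPED»; no side taken.
[cite: Mochizuki2012, IUTchIV Thm. 1.10 Steps (viii)–(x) p. 30–32] [claim: Mochizuki2012, status: disputed] -/
theorem keptMass_le_of_weightedDeficit_nonpos_of_hullEstimateOf_chosen {P : NFPoint} {l : ℕ} (T : Cor22.ThetaVolumeDatumAt P l) :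
    letI := T.instFieldF; letI := T.instNumberFieldF; letI := T.instAlgebraF; letI := T.instFieldK;
        letI := T.instNumberFieldK; letI := T.instAlgebraK; letI := T.instFieldFbar; letI := T.instAlgebraFbar;
        letI := T.instAlgebraKFbar; letI := T.instIsElliptic;
    ∀ (M : Type) [Field M] [NumberField M]
      (archPk : ∀ (j : (thetaIndex (pilotDataOfK T.D T.K)).Label) (vQ : (thetaIndex (pilotDataOfK T.D T.K)).VQ),
        Set ((logShellsDH (pilotDataOfK T.D T.K) (analyticLogv T.K)).Packet j vQ))
      (archSub : ∀ (j : (thetaIndex (pilotDataOfK T.D T.K)).Label) (v : (thetaIndex (pilotDataOfK T.D T.K)).V),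
        Set ((logShellsDH (pilotDataOfK T.D T.K) (analyticLogv T.K)).Packet j ((thetaIndex (pilotDataOfK T.D T.K)).over v)))
      (Ψ : ℤ → ∀ v : (thetaIndex (pilotDataOfK T.D T.K)).V, v ∈ (thetaIndex (pilotDataOfK T.D T.K)).Vbad →
        Set ((logShellsDH (pilotDataOfK T.D T.K) (analyticLogv T.K)).StarPacket v))
      (act : ℤ → ∀ v : (thetaIndex (pilotDataOfK T.D T.K)).V, v ∈ (thetaIndex (pilotDataOfK T.D T.K)).Vbad →
        (logShellsDH (pilotDataOfK T.D T.K) (analyticLogv T.K)).StarPacket v →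
          Module.End ℚ ((logShellsDH (pilotDataOfK T.D T.K) (analyticLogv T.K)).StarPacket v))
      (Mmod : ℤ → ∀ j : (thetaIndex (pilotDataOfK T.D T.K)).LabelStar,
        Set ((logShellsDH (pilotDataOfK T.D T.K) (analyticLogv T.K)).GlobalPacket j.1))
      (region : ℤ → ∀ j : (thetaIndex (pilotDataOfK T.D T.K)).LabelStar, FinDivisor M →
        ∀ vQ : (thetaIndex (pilotDataOfK T.D T.K)).VQ, Set ((logShellsDH (pilotDataOfK T.D T.K) (analyticLogv T.K)).Packet j.1 vQ))
      (n : ℤ) {HT : Type} {LogLink : HT → HT → Type} {IsFull : ∀ {s t : HT}, LogLink s t → Prop}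
      (lat : LGPGaussianLogThetaLattice LogLink IsFull)
      {Frd : Type} {IsoF : Frd → Frd → Type} {Ob : Frd → Type} {realify : Frd → Frd} {Strip : Type}
      {IsoS : Strip → Strip → Type}
      {Mv : ∀ v : (thetaIndex (pilotDataOfK T.D T.K)).V, v ∈ (thetaIndex (pilotDataOfK T.D T.K)).Vbad → Type}
      [∀ v h, Monoid (Mv v h)]
      (sig : GlobalLGPFrobenioidSignature (thetaIndex (pilotDataOfK T.D T.K)).lstar (thetaIndex (pilotDataOfK T.D T.K)).V
        (· ∈ (thetaIndex (pilotDataOfK T.D T.K)).Vbad) Frd IsoF Ob realify Strip IsoS Mv)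
      (split : SplittingMonoids Mv) {ObΔ : Type}
      {N : ∀ v : (thetaIndex (pilotDataOfK T.D T.K)).V, v ∈ (thetaIndex (pilotDataOfK T.D T.K)).Vbad → Type} [∀ v h, Monoid (N v h)]
      (qData : QPilotData ObΔ N)
      (ω : Fin (thetaIndex (pilotDataOfK T.D T.K)).lstar × (thetaIndex (pilotDataOfK T.D T.K)).VQ → ℝ) (δ : ℝ),
      (∀ c, ω c ≤ 1) →
      weightedDeficit
          (settingPrVolSharp (pilotDataOfK T.D T.K) (logvAnalytic_analyticLogv (F := T.K)) M archPk archSub Ψ act Mmod region n lat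
            sig split qData (exists_realising_qIdeles_pilotDataOfK T.D).choose (exists_realising_thetaIdeles_pilotDataOfK T.D).choose
            (exists_realising_qIdeles_pilotDataOfK T.D).choose_spec.1 (exists_realising_qIdeles_pilotDataOfK T.D).choose_spec.2.1) ω ≤ 0 →
      T.HullEstimateOf δ →
      weightedTrivialMass
          (settingPrVolSharp (pilotDataOfK T.D T.K) (logvAnalytic_analyticLogv (F := T.K)) M archPk archSub Ψ act Mmod region n lat
            sig split qData (exists_realising_qIdeles_pilotDataOfK T.D).choose (exists_realising_thetaIdeles_pilotDataOfK T.D).choose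
            (exists_realising_qIdeles_pilotDataOfK T.D).choose_spec.1 (exists_realising_qIdeles_pilotDataOfK T.D).choose_spec.2.1) (fun c => 1 - ω c) ≤
        δ + ThetaVolumeInput.archLogTheta l := by
  intro M _ _ archPk archSub Ψ act Mmod region n HT LogLink IsFull lat Frd IsoF Ob realify Strip IsoS Mv _ sig split ObΔ N _ qData ω δ hω hW hδ
  letI := T.instFieldF; letI := T.instNumberFieldF; letI := T.instAlgebraF; letI := T.instFieldK
  letI := T.instNumberFieldK; letI := T.instAlgebraK; letI := T.instFieldFbar; letI := T.instAlgebraFbar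
  letI := T.instAlgebraKFbar; letI := T.instIsElliptic
  have H := bridgeHyps_settingPrVolSharp_of_ideles (pilotDataOfK T.D T.K) (logvAnalytic_analyticLogv (F := T.K)) M archPk archSub Ψ act
    Mmod region n lat sig split qData (exists_realising_thetaIdeles_pilotDataOfK T.D).choose (exists_realising_qIdeles_pilotDataOfK T.D).choose
    (exists_realising_thetaIdeles_pilotDataOfK T.D).choose_spec.1 (exists_realising_thetaIdeles_pilotDataOfK T.D).choose_spec.2.1
    (exists_realising_qIdeles_pilotDataOfK T.D).choose_spec.1 (exists_realising_qIdeles_pilotDataOfK T.D).choose_spec.2.1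
  have h1 := gap_sub_le_of_statementUpTo_of_hullEstimateOf_chosen T M archPk archSub Ψ act Mmod region n lat sig split qData _ δ
    (statementUpTo_weightedTrivialMass_of_weightedDeficit_nonpos H hω hW) hδ
  have h2 := totalTrivialMass_chosen_eq_gap T M archPk archSub Ψ act Mmod region n lat sig split qData
  have h3 := weightedTrivialMass_eq_totalTrivialMass_sub H ω
  linarith

/-! ## §2. The two binders of every exponent end, met at one datum: the abc-type inequality AT THAT DATUM (N14 shape) -/

/-- **[MU] AND [CONE] AT ONE DATUM GIVE THE abc-TYPE INEQUALITY AT THAT DATUM.** At the chosen bed of `T`, for every slack `ε` with `StatementUpTo (setting) ε`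
(any tier), every `μ₀`, `A`, `δ`: [MU] `OffSigmaTolerance (1 − μ₀) A T ε` (i.e. `ε ≤ (1−μ₀)·T.gap + A`) ∧ [CONE] `T.HullEstimateOf δ` ⟹ **`μ₀·T.gap ≤ δ + A +
((l+5)/4)·log π`**. READING (R30 (3)/R33 (3), N14): the exponent ends' two content binders are jointly satisfiable at a datum only where the datum ALREADY obeys the
abc-type bound with constant `1/μ₀` (`T.gap = ((l+1)/24 − 1/(2l))·log q^{∤{2,l}}`, `A = Tol(P,l)`, `δ = B_III(P,l)`); a tier that raises the kept fraction at a
Szpiro-bad datum raises, by the same amount, the cone charge that must fail there — the RE-RUN table's cone column. Pure arithmetic on DEFINED numbers; nothing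
asserted about any datum; no side taken. [cite: Mochizuki2012, IUTchIV Thm. 1.10 Steps (viii)–(x) p. 30–32; Cor. 2.2 (ii) p. 46] [claim: Mochizuki2012, status: disputed] -/
theorem mu_mul_gap_le_of_offSigmaTolerance_of_hullEstimateOf_chosen {P : NFPoint} {l : ℕ} (T : Cor22.ThetaVolumeDatumAt P l) :
    letI := T.instFieldF; letI := T.instNumberFieldF; letI := T.instAlgebraF; letI := T.instFieldK;
        letI := T.instNumberFieldK; letI := T.instAlgebraK; letI := T.instFieldFbar; letI := T.instAlgebraFbar;
        letI := T.instAlgebraKFbar; letI := T.instIsElliptic;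
    ∀ (M : Type) [Field M] [NumberField M]
      (archPk : ∀ (j : (thetaIndex (pilotDataOfK T.D T.K)).Label) (vQ : (thetaIndex (pilotDataOfK T.D T.K)).VQ),
        Set ((logShellsDH (pilotDataOfK T.D T.K) (analyticLogv T.K)).Packet j vQ))
      (archSub : ∀ (j : (thetaIndex (pilotDataOfK T.D T.K)).Label) (v : (thetaIndex (pilotDataOfK T.D T.K)).V),
        Set ((logShellsDH (pilotDataOfK T.D T.K) (analyticLogv T.K)).Packet j ((thetaIndex (pilotDataOfK T.D T.K)).over v)))
      (Ψ : ℤ → ∀ v : (thetaIndex (pilotDataOfK T.D T.K)).V, v ∈ (thetaIndex (pilotDataOfK T.D T.K)).Vbad →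
        Set ((logShellsDH (pilotDataOfK T.D T.K) (analyticLogv T.K)).StarPacket v))
      (act : ℤ → ∀ v : (thetaIndex (pilotDataOfK T.D T.K)).V, v ∈ (thetaIndex (pilotDataOfK T.D T.K)).Vbad →
        (logShellsDH (pilotDataOfK T.D T.K) (analyticLogv T.K)).StarPacket v →
          Module.End ℚ ((logShellsDH (pilotDataOfK T.D T.K) (analyticLogv T.K)).StarPacket v))
      (Mmod : ℤ → ∀ j : (thetaIndex (pilotDataOfK T.D T.K)).LabelStar,
        Set ((logShellsDH (pilotDataOfK T.D T.K) (analyticLogv T.K)).GlobalPacket j.1))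
      (region : ℤ → ∀ j : (thetaIndex (pilotDataOfK T.D T.K)).LabelStar, FinDivisor M →
        ∀ vQ : (thetaIndex (pilotDataOfK T.D T.K)).VQ, Set ((logShellsDH (pilotDataOfK T.D T.K) (analyticLogv T.K)).Packet j.1 vQ))
      (n : ℤ) {HT : Type} {LogLink : HT → HT → Type} {IsFull : ∀ {s t : HT}, LogLink s t → Prop}
      (lat : LGPGaussianLogThetaLattice LogLink IsFull)
      {Frd : Type} {IsoF : Frd → Frd → Type} {Ob : Frd → Type} {realify : Frd → Frd} {Strip : Type}
      {IsoS : Strip → Strip → Type}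
      {Mv : ∀ v : (thetaIndex (pilotDataOfK T.D T.K)).V, v ∈ (thetaIndex (pilotDataOfK T.D T.K)).Vbad → Type}
      [∀ v h, Monoid (Mv v h)]
      (sig : GlobalLGPFrobenioidSignature (thetaIndex (pilotDataOfK T.D T.K)).lstar (thetaIndex (pilotDataOfK T.D T.K)).V
        (· ∈ (thetaIndex (pilotDataOfK T.D T.K)).Vbad) Frd IsoF Ob realify Strip IsoS Mv)
      (split : SplittingMonoids Mv) {ObΔ : Type}
      {N : ∀ v : (thetaIndex (pilotDataOfK T.D T.K)).V, v ∈ (thetaIndex (pilotDataOfK T.D T.K)).Vbad → Type} [∀ v h, Monoid (N v h)]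
      (qData : QPilotData ObΔ N) (ε μ₀ A δ : ℝ),
      StatementUpTo
          (settingPrVolSharp (pilotDataOfK T.D T.K) (logvAnalytic_analyticLogv (F := T.K)) M archPk archSub Ψ act Mmod region n lat
            sig split qData (exists_realising_qIdeles_pilotDataOfK T.D).choose (exists_realising_thetaIdeles_pilotDataOfK T.D).choose
            (exists_realising_qIdeles_pilotDataOfK T.D).choose_spec.1 (exists_realising_qIdeles_pilotDataOfK T.D).choose_spec.2.1) ε →
      OffSigmaTolerance (1 - μ₀) A T ε → T.HullEstimateOf δ →
      μ₀ * T.gap ≤ δ + A + ThetaVolumeInput.archLogTheta l := by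
  intro M _ _ archPk archSub Ψ act Mmod region n HT LogLink IsFull lat Frd IsoF Ob realify Strip IsoS Mv _ sig split ObΔ N _ qData ε μ₀ A δ hst hμ hδ
  letI := T.instFieldF; letI := T.instNumberFieldF; letI := T.instAlgebraF; letI := T.instFieldK
  letI := T.instNumberFieldK; letI := T.instAlgebraK; letI := T.instFieldFbar; letI := T.instAlgebraFbar
  letI := T.instAlgebraKFbar; letI := T.instIsElliptic
  have h1 := gap_sub_le_of_statementUpTo_of_hullEstimateOf_chosen T M archPk archSub Ψ act Mmod region n lat sig split qData ε δ hst hδ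
  rw [offSigmaTolerance_iff] at hμ
  nlinarith

end Summit.ABC.IUTFork.Conditional.SigmaMass

end
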